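import Literature.Probability.Percolation.SlabGluingFact2
import HarnessLib

/-!
# DST 2016, §2.1: the waypoints eq. (13), eq. (13'), eq. (1'), eq. (12'), eq. (12), eq. (1) and the finite-size criterion discharged

Topic: `Literature/Probability/Percolation`. Discharge of the named fact
`DuminilCopinSidoraviciusTassion2016_eq13` of `SlabCriticality.lean` (Duminil-Copin–Sidoravicius–
Tassion 2016, §2.1, eq. (13) = arXiv (2.6): for `k > 0`, `p` with `θ_{S_k}(p) > 0` and ANY sequence
`(u_n)` with `u_n ≤ n/3` and `P_p[B_{u_n} ⟷^{!B_n!} ∂B_n] → 1`,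
`limsup_n P_p[S_{3n} ⟷^{(2n,0)+B_{6n}} (4n,0)+S_{3n}] = 1`, `S_n = B_{u_n}`).

`SlabCriticality.lean` cannot import the end of the chain (`SlabGluingFact2.lean`, where the Gluing
Lemma 6 is proved in the range `u_{3n} + 1 ≤ n`, `DuminilCopinSidoraviciusTassion2016_lemma6'_holds`)
without an import cycle, hence this sibling file.

## The argument

The tree proves eq. (13) for sequences with `u_n ≤ n/4` (`DuminilCopinSidoraviciusTassion2016_eq13'`,
`SlabCriticalityChain4.lean`, from Lemma 4, Lemma 6' and eqs. (10)–(12) exactly as printed) and the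
existence of ONE such sequence `(u'_n)` from the uniqueness of the infinite cluster
(`DuminilCopinSidoraviciusTassion2016_eq1'_of_uniqueCluster`, `…_uniqueCluster_holds`). Given an
arbitrary `(u_n)` as in eq. (1) (`u_n ≤ n/3`), put `w_n := min (u_n, u'_n)`. Then `w_n ≤ n/4`, and for
each `n` the uniqueness event `{B_{w_n} ⟷^{!B_n!} ∂B_n}` IS the one of `u_n` or the one of `u'_n`, so
its probability is at least the minimum of the two and still tends to `1`; eq. (13') for `(w_n)` gives
scales `n` with `P_p[B_{w_{3n}} ⟷^{(2n,0)+B_{6n}} (4n,0)+B_{w_{3n}}] > 1 - ε`, and the event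
`X ⟷^B Y` is monotone in `X`, `Y` (`slabConn_mono`), `B_{w_{3n}} ⊆ B_{u_{3n}} = S_{3n}`. (The paper
fixes one sequence `(u_n)` once and for all, p. 5 of arXiv:1401.7130; the tree's `…_eq13`
quantifies over all admissible sequences, which this reduction handles.)

* `slabConn_mono` — PROVED: `X ⊆ X'`, `Y ⊆ Y'` ⇒ `{X ⟷^B Y} ⊆ {X' ⟷^B Y'}`.
* `DuminilCopinSidoraviciusTassion2016_eq1'_holds`, `…_eq13'_holds` — PROVED (assembly of the
  proved chain of `SlabCriticalityChain4.lean`, `SlabUniqueness.lean`, `SlabGluingFact2.lean`).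
* `DuminilCopinSidoraviciusTassion2016_eq13_holds` — PROVED: the named fact `…_eq13` DISCHARGED.
* `tendsto_real_slabUniqueConn_min` — PROVED: the uniqueness probabilities along `min (u_n, u'_n)` tend
  to `1` when those along `(u_n)` and `(u'_n)` do (termwise the event is one of the two).
* `DuminilCopinSidoraviciusTassion2016_eq12'_holds` — PROVED: the waypoint `…_eq12'` of
  `SlabCriticalityChain4.lean` (eq. (12) for `u_n ≤ n/4`) DISCHARGED (`…_eq12'_of_lemmas` with
  `…_lemma4_holds`, `…_lemma6'_holds`).
* `DuminilCopinSidoraviciusTassion2016_eq12_holds` — PROVED: the named fact `…_eq12` of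
  `SlabCriticality.lean` (DST 2016, §2.1, eq. (12) = arXiv (2.5), p. 6: "Lemma 6 and (11) imply
  `limsup_{n→∞} P_p[S_{3n} ⟷^{B_{4n}} S'_n] = 1`", for every admissible `(u_n)`, `u_n ≤ n/3`)
  DISCHARGED by the same reduction: eq. (12') for `w_n = min (u_n, u'_n)` supplies `(y_n)` and the
  scales `n`, and `{B_{w_{3n}} ⟷^{B_{4n}} (2n, y_{3n}) + B_{w_n}} ⊆ {S_{3n} ⟷^{B_{4n}} (2n, y_{3n}) + S_n}`
  (`slabConn_mono`).
* `DuminilCopinSidoraviciusTassion2016_eq1_holds` — PROVED: the named fact `…_eq1` of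
  `SlabCriticality.lean` (eq. (1) in the printed normalisation `u_n ≤ n/3`) DISCHARGED
  (`…_eq1_of_uniqueCluster` of `SlabCriticalityInputs.lean` with `…_uniqueCluster_holds`).
* `DuminilCopinSidoraviciusTassion2016_goodEvent_likely_holds` — PROVED: **the finite-size criterion
  of §§2.1–2.2**, the named fact `…_goodEvent_likely` of `SlabCriticality.lean`, DISCHARGED: for
  `k > 0`, `θ_{S_k}(p) > 0` and `η > 0` there are `n ≥ 1` and `u ≤ n` such that both coarse edges at
  the origin are good with `P_p`-probability `> 1 - η` (DST 2016, §2.2: "Equations (13) and (1)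
  guarantee the existence of `n` such that the `P_p`-probability that an edge is good is larger
  than `1 - η`"), by `…_goodEvent_likely_of_eq1_eq13` (`SlabCriticality.lean`: union bound,
  translation invariance, diagonal reflection) from `…_eq1_holds` and `…_eq13_holds`.

Still named facts (neither restated nor used here): `…_lemma6` and `…_fact2` verbatim (the Gluing
Lemma also at scales with `u_{3n} = n`, resp. Fact 2 for every `t ≥ 1`; see `SlabGluingFact2.lean`,
"Why large `t`").

## Sources

* H. Duminil-Copin, V. Sidoravicius, V. Tassion, *Absence of infinite cluster for critical
  Bernoulli percolation on slabs*, Comm. Pure Appl. Math. 69 (2016), 1397–1411, arXiv:1401.7130: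
  §2.1, eq. (1) (arXiv (2.1), p. 5) and eq. (13) (arXiv (2.6), p. 6: "Using (12) and (1), we find
  `limsup_{n→∞} P_p[S_{3n} ⟷^{(2n,0)+B_{6n}} (4n,0)+S_{3n}] = 1`").
  Eq. (12) is arXiv (2.5), p. 6 (`B'_n = (2n, y) + B_n`, `S'_n = (2n, y) + S_n`, `y = y_{3n}`, p. 5;
  `B_{3n} ∪ B'_n ⊆ B_{4n}`).
  §2.2, first paragraph after the definition of good edges (arXiv p. 6): "Equations (13) and (1)
  guarantee the existence of `n` such that the `P_p`-probability that an edge is good is larger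
  than `1 - η`" (the finite-size criterion).

Nothing else of the paper is restated here; Thm. 1 itself is `DuminilCopinSidoraviciusTassion2016_holds`
(`SlabGluingFact2.lean`).
-/

noncomputable section

open MeasureTheory Filter Set
open scoped Topology

namespace Literature.Probability.Percolation

open LatticeModels

/-- `X ⟷^B Y` is monotone in the two target sets: if `X ⊆ X'` and `Y ⊆ Y'` then
`{X ⟷^B Y} ⊆ {X' ⟷^B Y'}` (an open cluster of `B̄` meeting `X̄` and `Ȳ` meets `X̄'` and `Ȳ'`).
(Grimmett 1999, §11.3, monotonicity of crossing events.) [folklore] -/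
theorem slabConn_mono (k : ℕ) {B X X' Y Y' : Set (ℤ × ℤ)} (hX : X ⊆ X') (hY : Y ⊆ Y') :
    slabConn k B X Y ⊆ slabConn k B X' Y' :=
  openCrossing_mono subset_rfl (slabLift_mono k hX) (slabLift_mono k hY)

/-- PROVED — **DST 2016, §2.1, eq. (1) with `u_n ≤ n/4`**: for `k > 0` and `θ_{S_k}(p) > 0` there is
a sequence `(u_n)` with `4 u_n ≤ n` and `P_p[B_{u_n} ⟷^{!B_n!} ∂B_n] → 1`; the named waypoint
`DuminilCopinSidoraviciusTassion2016_eq1'` DISCHARGED (uniqueness of the infinite cluster on slabs,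
`DuminilCopinSidoraviciusTassion2016_uniqueCluster_holds`, and the diagonal extraction
`DuminilCopinSidoraviciusTassion2016_eq1'_of_uniqueCluster`).
[cite: DuminilCopinSidoraviciusTassion2016, §2.1 eq. (1)] -/
theorem DuminilCopinSidoraviciusTassion2016_eq1'_holds : DuminilCopinSidoraviciusTassion2016_eq1' :=
  DuminilCopinSidoraviciusTassion2016_eq1'_of_uniqueCluster
    DuminilCopinSidoraviciusTassion2016_uniqueCluster_holds

/-- PROVED — **DST 2016, §2.1, eq. (13) for sequences with `u_n ≤ n/4`**: the named waypoint
`DuminilCopinSidoraviciusTassion2016_eq13'` DISCHARGED, from Lemma 4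
(`DuminilCopinSidoraviciusTassion2016_lemma4_holds`), the Gluing Lemma 6 in the range `u_{3n} + 1 ≤ n`
(`DuminilCopinSidoraviciusTassion2016_lemma6'_holds`) and eqs. (10)–(12)
(`…_eq12'_of_lemmas`, `…_eq13'_of_eq12'`). [cite: DuminilCopinSidoraviciusTassion2016, §2.1 eq. (13)] -/
theorem DuminilCopinSidoraviciusTassion2016_eq13'_holds : DuminilCopinSidoraviciusTassion2016_eq13' :=
  DuminilCopinSidoraviciusTassion2016_eq13'_of_eq12'
    (DuminilCopinSidoraviciusTassion2016_eq12'_of_lemmas DuminilCopinSidoraviciusTassion2016_lemma4_holds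
      DuminilCopinSidoraviciusTassion2016_lemma6'_holds)

/-- PROVED — **Duminil-Copin–Sidoravicius–Tassion 2016, §2.1, eq. (13)** (arXiv (2.6)): for `k > 0`,
`p` with `P_p[0 ↔ ∞ in S_k] > 0` and any `(u_n)` with `u_n ≤ n/3` and
`P_p[B_{u_n} ⟷^{!B_n!} ∂B_n] → 1` (`S_n = B_{u_n}`),
"`limsup_{n → ∞} P_p[S_{3n} ⟷^{(2n,0)+B_{6n}} (4n,0)+S_{3n}] = 1`"; the named fact
`DuminilCopinSidoraviciusTassion2016_eq13` of `SlabCriticality.lean` DISCHARGED. Proof: with `(u'_n)`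
from `…_eq1'_holds` put `w_n = min (u_n, u'_n)`; then `4 w_n ≤ n`, the uniqueness probabilities
along `(w_n)` are termwise one of the two given ones, hence `→ 1`, and eq. (13') for `(w_n)`
(`…_eq13'_holds`) transfers to `(u_n)` by `slabConn_mono` (`B_{w_{3n}} ⊆ B_{u_{3n}}`).
[cite: DuminilCopinSidoraviciusTassion2016, §2.1 eq. (13)] -/
theorem DuminilCopinSidoraviciusTassion2016_eq13_holds : DuminilCopinSidoraviciusTassion2016_eq13 := by
  intro k hk p hθ u hu3 hlim ε hε N
  obtain ⟨u', hu'4, hlim'⟩ := DuminilCopinSidoraviciusTassion2016_eq1'_holds k hk p hθ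
  -- the sequence `w_n = min (u_n, u'_n)` is admissible for eq. (13')
  have hw4 : ∀ n, 4 * min (u n) (u' n) ≤ n := fun n =>
    (Nat.mul_le_mul_left 4 (min_le_right _ _)).trans (hu'4 n)
  have hwlim : Tendsto (fun n => (bondPercolation (slabGraph 3 k) p).real
      (slabUniqueConn k (sqBox 0 n) (sqBox 0 (min (u n) (u' n))) (sqSphere 0 n))) atTop (nhds 1) := by
    have hmin : Tendsto (fun n => min
        ((bondPercolation (slabGraph 3 k) p).real
          (slabUniqueConn k (sqBox 0 n) (sqBox 0 (u n)) (sqSphere 0 n)))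
        ((bondPercolation (slabGraph 3 k) p).real
          (slabUniqueConn k (sqBox 0 n) (sqBox 0 (u' n)) (sqSphere 0 n)))) atTop (nhds 1) := by
      simpa using hlim.min hlim'
    refine tendsto_of_tendsto_of_tendsto_of_le_of_le hmin tendsto_const_nhds (fun n => ?_)
      fun n => measureReal_le_one
    rcases le_total (u n) (u' n) with h | h
    · simp only [min_eq_left h]
      exact min_le_left _ _
    · simp only [min_eq_right h]
      exact min_le_right _ _
  obtain ⟨n, hn, h13⟩ :=
    DuminilCopinSidoraviciusTassion2016_eq13'_holds k hk p hθ (fun n => min (u n) (u' n)) hw4 hwlim ε hε N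
  refine ⟨n, hn, h13.trans_le (measureReal_mono ?_)⟩
  exact slabConn_mono k (sqBox_mono _ (min_le_left _ _)) (sqBox_mono _ (min_le_left _ _))

/-- The uniqueness probabilities along the termwise minimum of two radius sequences tend to `1` when
they do along each: for every `n` the event `{B_{min(u_n,u'_n)} ⟷^{!B_n!} ∂B_n}` is the one of `u_n`
or the one of `u'_n`. [folklore] -/
theorem tendsto_real_slabUniqueConn_min (k : ℕ) (p : unitInterval) {u u' : ℕ → ℕ}
    (hlim : Tendsto (fun n => (bondPercolation (slabGraph 3 k) p).real
      (slabUniqueConn k (sqBox 0 n) (sqBox 0 (u n)) (sqSphere 0 n))) atTop (nhds 1))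
    (hlim' : Tendsto (fun n => (bondPercolation (slabGraph 3 k) p).real
      (slabUniqueConn k (sqBox 0 n) (sqBox 0 (u' n)) (sqSphere 0 n))) atTop (nhds 1)) :
    Tendsto (fun n => (bondPercolation (slabGraph 3 k) p).real
      (slabUniqueConn k (sqBox 0 n) (sqBox 0 (min (u n) (u' n))) (sqSphere 0 n))) atTop (nhds 1) := by
  have hmin : Tendsto (fun n => min
      ((bondPercolation (slabGraph 3 k) p).real
        (slabUniqueConn k (sqBox 0 n) (sqBox 0 (u n)) (sqSphere 0 n)))
      ((bondPercolation (slabGraph 3 k) p).real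
        (slabUniqueConn k (sqBox 0 n) (sqBox 0 (u' n)) (sqSphere 0 n)))) atTop (nhds 1) := by
    simpa using hlim.min hlim'
  refine tendsto_of_tendsto_of_tendsto_of_le_of_le hmin tendsto_const_nhds (fun n => ?_)
    fun n => measureReal_le_one
  rcases le_total (u n) (u' n) with h | h
  · simp only [min_eq_left h]
    exact min_le_left _ _
  · simp only [min_eq_right h]
    exact min_le_right _ _

/-- PROVED — **DST 2016, §2.1, eq. (12) for sequences with `u_n ≤ n/4`**: the named waypoint
`DuminilCopinSidoraviciusTassion2016_eq12'` of `SlabCriticalityChain4.lean` DISCHARGED, from Lemma 4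
(`DuminilCopinSidoraviciusTassion2016_lemma4_holds`, square-root trick), Lemma 5, eqs. (10)–(11) and
the Gluing Lemma 6 in the range `u_{3n} + 1 ≤ n` (`DuminilCopinSidoraviciusTassion2016_lemma6'_holds`),
assembled by `DuminilCopinSidoraviciusTassion2016_eq12'_of_lemmas`.
[cite: DuminilCopinSidoraviciusTassion2016, §2.1 eq. (12)] -/
theorem DuminilCopinSidoraviciusTassion2016_eq12'_holds : DuminilCopinSidoraviciusTassion2016_eq12' :=
  DuminilCopinSidoraviciusTassion2016_eq12'_of_lemmas DuminilCopinSidoraviciusTassion2016_lemma4_holds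
    DuminilCopinSidoraviciusTassion2016_lemma6'_holds

/-- PROVED — **Duminil-Copin–Sidoravicius–Tassion 2016, §2.1, eq. (12)** (arXiv (2.5), p. 6:
"Lemma 6 and (11) imply that `limsup_{n → ∞} P_p[S_{3n} ⟷^{B_{4n}} S'_n] = 1`", with
`S'_n = (2n, y_{3n}) + S_n`, `S_n = B_{u_n}`): for `k > 0`, `p` with `P_p[0 ↔ ∞ in S_k] > 0` and ANY
`(u_n)` with `u_n ≤ n/3` and `P_p[B_{u_n} ⟷^{!B_n!} ∂B_n] → 1` there is `(y_n)`, `y_n ∈ [0, n]`, with,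
for every `ε > 0` and `N`, a scale `n ≥ N` at which `P_p[S_{3n} ⟷^{B_{4n}} (2n, y_{3n}) + S_n] > 1 - ε`;
the named fact `DuminilCopinSidoraviciusTassion2016_eq12` of `SlabCriticality.lean` DISCHARGED.
Proof: with `(u'_n)` from `…_eq1'_holds` put `w_n = min (u_n, u'_n)`; then `4 w_n ≤ n`, the
uniqueness probabilities along `(w_n)` tend to `1` (`tendsto_real_slabUniqueConn_min`), eq. (12')
for `(w_n)` (`…_eq12'_holds`) supplies `(y_n)` and the scales, and the crossing event is monotone in
its source and target (`slabConn_mono`; `B_{w_m} ⊆ B_{u_m}`). (The paper fixes one sequence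
`(u_n)`, p. 5; the tree's `…_eq12` quantifies over all admissible ones, and the Gluing Lemma is
available in the range `u_{3n} + 1 ≤ n`, which `4 w_{3n} ≤ 3n` guarantees.)
[cite: DuminilCopinSidoraviciusTassion2016, §2.1 eq. (12)] -/
theorem DuminilCopinSidoraviciusTassion2016_eq12_holds : DuminilCopinSidoraviciusTassion2016_eq12 := by
  intro k hk p hθ u _hu3 hlim
  obtain ⟨u', hu'4, hlim'⟩ := DuminilCopinSidoraviciusTassion2016_eq1'_holds k hk p hθ
  -- the sequence `w_n = min (u_n, u'_n)` is admissible for eq. (12')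
  have hw4 : ∀ n, 4 * min (u n) (u' n) ≤ n := fun n =>
    (Nat.mul_le_mul_left 4 (min_le_right _ _)).trans (hu'4 n)
  obtain ⟨y, hy, h12⟩ := DuminilCopinSidoraviciusTassion2016_eq12'_holds k hk p hθ
    (fun n => min (u n) (u' n)) hw4 (tendsto_real_slabUniqueConn_min k p hlim hlim')
  refine ⟨y, hy, fun ε hε N => ?_⟩
  obtain ⟨n, hn, h12n⟩ := h12 ε hε N
  refine ⟨n, hn, h12n.trans_le (measureReal_mono ?_)⟩
  exact slabConn_mono k (sqBox_mono _ (min_le_left _ _)) (sqBox_mono _ (min_le_left _ _))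

/-! ## eq. (1) and the finite-size criterion of §§2.1–2.2 discharged -/

/-- PROVED — **DST 2016, §2.1, eq. (1)** in the printed normalisation `u_n ≤ n/3`: for `k > 0` and
`θ_{S_k}(p) > 0` there is a sequence `(u_n)` with `3 u_n ≤ n` and `P_p[B_{u_n} ⟷^{!B_n!} ∂B_n] → 1`
("The infinite cluster in `S_k` being unique almost surely, one can construct a sequence
`(u_n)_{n ≥ 1}` such that `u_n ≤ n/3` and `lim_n P_p[B_{u_n} ⟷^{!B_n!} ∂B_n] = 1`", arXiv p. 5); the
named fact `DuminilCopinSidoraviciusTassion2016_eq1` of `SlabCriticality.lean` DISCHARGED, by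
`DuminilCopinSidoraviciusTassion2016_eq1_of_uniqueCluster` (`SlabCriticalityInputs.lean`: zero–one law,
uniqueness, diagonal extraction) and the uniqueness of the infinite cluster on slabs
(`DuminilCopinSidoraviciusTassion2016_uniqueCluster_holds`, `SlabUniqueness.lean`).
[cite: DuminilCopinSidoraviciusTassion2016, §2.1 eq. (1)] -/
theorem DuminilCopinSidoraviciusTassion2016_eq1_holds : DuminilCopinSidoraviciusTassion2016_eq1 :=
  DuminilCopinSidoraviciusTassion2016_eq1_of_uniqueCluster
    DuminilCopinSidoraviciusTassion2016_uniqueCluster_holds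

/-- PROVED — **Duminil-Copin–Sidoravicius–Tassion 2016, §§2.1–2.2: the finite-size criterion holds
when `θ_{S_k}(p) > 0`**; the named fact `DuminilCopinSidoraviciusTassion2016_goodEvent_likely` of
`SlabCriticality.lean` DISCHARGED. For `k > 0`, `p` with `P_p[0 ↔ ∞ in S_k] > 0` and `η > 0` there are a
block size `n ≥ 1` and a radius `u ≤ n` (`S_{3n} = B_u`) such that both coarse edges at the origin,
`{0, 4n e₀}` and `{0, 4n e₁}`, are good with `P_p`-probability `> 1 - η` (DST 2016, §2.2:
"Equations (13) and (1) guarantee the existence of `n` such that the `P_p`-probability that an edge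
is good is larger than `1 - η`"). The proof is the paper's §2.1 end to end, assembled from the
tree: eq. (1) from the uniqueness of the infinite cluster (`DuminilCopinSidoraviciusTassion2016_eq1_holds`),
eq. (13) from Lemmata 4–7, Facts 1–2 and eqs. (10)–(12) (`DuminilCopinSidoraviciusTassion2016_eq13_holds`),
and the union bound with the translation invariance and the diagonal reflection of the slab
(`DuminilCopinSidoraviciusTassion2016_goodEvent_likely_of_eq1_eq13`, `SlabCriticality.lean`).
[cite: DuminilCopinSidoraviciusTassion2016, §2.1 eq. (13) and §2.2] -/
theorem DuminilCopinSidoraviciusTassion2016_goodEvent_likely_holds :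
    DuminilCopinSidoraviciusTassion2016_goodEvent_likely :=
  DuminilCopinSidoraviciusTassion2016_goodEvent_likely_of_eq1_eq13
    DuminilCopinSidoraviciusTassion2016_eq1_holds DuminilCopinSidoraviciusTassion2016_eq13_holds

end Literature.Probability.Percolation

end
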